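import Summits.BirchSwinnertonDyer.Rank1Residual.X11b.CongruentSelmerTransferTransport
import HarnessLib
/-!
# The congruent-curve Selmer transfer, typed: "strict ⊂ Selmer ⊂ relaxed" for `E[p] ≅ Y[p]` — §3–§4
# (BSD rank-≤1 residual cell, instrument seat sha-2 = EXACT Ш CERTIFICATION per residual curve, ODD `p`)

This file is part 2/5: §3–§4 the relaxed/strict count at two places.

HONEST FRAMING (cell `b2b-bsdres-*`, verbatim): prove what is provable now; shrink each hard class to
its core with data; no claim beyond stated classes. This file is a TOOL of the Ш-census instrument
(unit `b2b-bsdres-sha-2`, gen 25; method note `HOME/b2b-bsdres-sha-2/gen24/llt/METHODS-LLT.md`,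
rule V22 "level-lowering transfer"); it changes NO census label (the census-lead's word decides labels),
mints NO named fact, and every published input below is a HYPOTHESIS binder, never an axiom.

PROVENANCE: this is part 2 of 5 of the module staged by the instrument seat sha-2 (GEN 25) as ONE
file (`HOME/b2b-bsdres-sha-2/gen25/lean/CongruentSelmerTransfer.lean`, sha256
`2f6acc73dd7f03230d5512c6b630a96415548b50b335f76e51e9fa9bdd5049da`, 1273 lines, farm-checked), filed
by harvest-2 (GEN 52) in five parts ONLY because the gate caps new `Summits/` files at 400 lines
(`lint.size`: "split by topic"), after the gate-dictated `dedup.landed` patch (two folklore helpers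
restated landed tree lemmas: the Lagrange identity `#H · [K : H] = #K` ≡
`X11b.SelmerCount.card_mul_relIndex_of_le` — its three uses now rewrite with Mathlib's
`AddSubgroup.relIndex_bot_left` / `relIndex_mul_relIndex` inline — and `selmerGroup_mono` ≡
`GaloisImage.CoreRankZero.selmerGroup_mono`, now imported and `open`ed so its call sites are
unchanged; +1 import, +1 `open`; nothing else: `dedup.patch`, 21 changed lines). The lines strictly
between the `BEGIN VERBATIM` / `END VERBATIM` markers below are lines of that patched module
(`CongruentSelmerTransfer.dedup-full.lean`, sha256
`0cc2a4cfb35889efdf8f50303ab169676f906a9294b8738119fc9cdab1ce586f`) byte for byte — declarations,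
proofs and docstrings as staged, in the staged order, in the staged namespace (every declaration
keeps its fully qualified name); imports are chained part 1 → 2 → 3 → 4 → 5. Split kit (the 5 files,
`dedup.patch`, `manifest.tsv` decl → part:line, SHA256SUMS, `make_dedup.py` / `make_split.py` /
`verify_split.py`): `HOME/b2b-bsdres-harvest-2/gen52/split/`.
Parts: 1 `X11b/CongruentSelmerTransferTransport.lean` (§0–§2; patched-module lines 91–382) · 2
`X11b/CongruentSelmerTransferTwoPlaces.lean` (§3–§4; patched-module lines 383–674) · 3
`X11b/CongruentSelmerTransferBounds.lean` (§5, first half; patched-module lines 675–894) · 4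
`X11b/CongruentSelmerTransferRules.lean` (§5, second half; §6 slack; patched-module lines 895–1088)
· 5 `X11b/CongruentSelmerTransfer.lean` (§6 over ℚ; patched-module lines 1089–1262); part 5 carries
the FULL module docstring of the staged file (what is PROVED, what stays a HYPOTHESIS, references).
-/

noncomputable section

open scoped Classical

universe u

open CategoryTheory Field Function NumberField IsDedekindDomain WeierstrassCurve
open Literature.NumberTheory.EllipticCurves
open Literature.NumberTheory.GaloisRepresentations
open Literature.NumberTheory.GaloisRepresentations.DiscreteGaloisModule (SelmerStructure unramifiedSubgroup)
open Literature.NumberTheory.GaloisCohomology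
open Summit.BirchSwinnertonDyer.Rank1Residual.X11b.Levels
open Summit.BirchSwinnertonDyer.Rank1Residual.GaloisImage.CoreRankZero (selmerGroup_mono)
open scoped ContRepresentation

namespace Summit.BirchSwinnertonDyer.Rank1Residual.X11b.CongruentTransfer

-- BEGIN VERBATIM: patched-module lines 383–674 (sha256 0cc2a4cfb35889ef…)
/-! ## §3. The relaxed/strict count at TWO finite places for a residually self-dual structure:
`[H¹_{𝓛^{v₁v₂}} : H¹_{𝓛_{v₁v₂}}]² = #H¹(K_{v₁}, E[n]) · #H¹(K_{v₂}, E[n])` -/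

section TwoPlaces

-- Cup products need `LocallyCompactSpace Γ`; as in the tree's cup-product files, the compactness of
-- absolute Galois groups is a local instance only; so are the finiteness of `E[n]` and of `μₙ`.
attribute [local instance] absoluteGaloisGroup_compactSpace
attribute [local instance] finite_geomTorsion_of_neZero Literature.NumberTheory.EllipticCurves.finite_muCarrier

open Summit.BirchSwinnertonDyer.Rank1Residual.X11b.LocBridge
open Summit.BirchSwinnertonDyer.Rank1Residual.X5.SelfDualCount

variable {K : Type} [Field K] [NumberField K] (W : WeierstrassCurve K) (n : ℕ) [NeZero n]
  [W.IsElliptic]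
variable (e : geomTorsion W n → geomTorsion W n → AlgebraicClosure K)
  (hμ : ∀ S T, e S T ^ n = 1)
  (hadd₁ : ∀ S₁ S₂ T, e (S₁ + S₂) T = e S₁ T * e S₂ T)
  (hadd₂ : ∀ S T₁ T₂, e S (T₁ + T₂) = e S T₁ * e S T₂)
  (hgal : ∀ (σ : absoluteGaloisGroup K) (S T : geomTorsion W n), σ • e S T = e (σ • S) (σ • T))
  (hnondeg : ∀ T, (∀ S, e S T = 1) → T = 0)
  (inv : LocalInvariants K n)

omit [NeZero n] [W.IsElliptic] in
/-- Monotonicity of `Function.update` in the Selmer structure and in the new local condition. [folklore] -/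
theorem update_le_update {𝓐 𝓑 : SelmerStructure (W.torsionGaloisModule n)} (h : 𝓐 ≤ 𝓑) (v₀ : Place K)
    {L L' : AddSubgroup (galoisCohomology ((W.torsionGaloisModule n).toLocal v₀) 1)} (hL : L ≤ L') :
    Function.update 𝓐 v₀ L ≤ Function.update 𝓑 v₀ L' := by
  intro v
  by_cases hv : v = v₀
  · subst hv; rw [Function.update_self, Function.update_self]; exact hL
  · rw [Function.update_of_ne hv, Function.update_of_ne hv]; exact h v

include hnondeg in
/-- **The self-dual relaxed/strict count at TWO finite places.** For `inv` with the three Poitou–Tate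
properties, `S ⊇ {v ∣ ∞} ∪ {v ∣ n} ∪ Ram(E[n])` finite, `𝓛` unramified outside `S` and residually
self-dual EVERYWHERE (`w⁻¹(𝓛_v^*) = 𝓛_v`), and two distinct finite places `v₁ ≠ v₂` of `S`:

  `[H¹_{𝓛^{v₁ v₂}} : H¹_{𝓛_{v₁ v₂}}]² = #H¹(K_{v₁}, E[n]) · #H¹(K_{v₂}, E[n])`,

where `𝓛^{v₁v₂}` / `𝓛_{v₁v₂}` are `𝓛` made `⊤` / `⊥` at both places. Proof: the one-place counting form
of Howard Thm. 2.1.11 (`X11b.PoitouTateCounting.relIndex_selmerGroup_mul_relIndex_dual_eq`) twice —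
at `v₁` for `𝓛_{v₁v₂} ≤ 𝓛^{v₁}_{v₂}` and at `v₂` for `𝓛_{v₁v₂} ≤ 𝓛_{v₁}^{v₂}` — the dual Selmer groups
being the Weil transports of `H¹_{𝓛^{v₁v₂}}`, `H¹_{𝓛_{v₁}^{v₂}}`, `H¹_{𝓛^{v₁}_{v₂}}` (X5 §1–§2 and
self-duality); the product of the two identities is `[𝓛^{v₁v₂} : 𝓛_{v₁v₂}]²`. The two-place case of
Mazur–Rubin's `dim Sel^T − dim Sel_T = Σ_{v ∈ T} ½ dim H¹(K_v, E[p])`.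
[cite: Howard2004HeegnerKolyvagin, Thm. 2.1.11 (arXiv:1202.6340 p. 6)]
[cite: MazurRubin2010, Lemma 3.2 (arXiv:0904.3709 p. 10)] -/
theorem relIndex_update₂_bot_update₂_top_sq_eq (hperf : inv.IsPerfect)
    (hvan : inv.SumLocalTermEqZero) (hcomp : inv.SelmerComplement) {S : Finset (Place K)}
    (hS : ∀ v : HeightOneSpectrum (𝓞 K), (Sum.inr v : Place K) ∉ S →
      ((n : ℕ) : 𝓞 K) ∉ v.asIdeal ∧ GaloisRep.IsUnramifiedAt v (W.torsionGaloisModule n))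
    {𝓛 : SelmerStructure (W.torsionGaloisModule n)} (h𝓛 : 𝓛.IsUnramifiedOutside S)
    {w₁ w₂ : HeightOneSpectrum (𝓞 K)} (hw₁ : (Sum.inr w₁ : Place K) ∈ S)
    (hw₂ : (Sum.inr w₂ : Place K) ∈ S) (hne : w₁ ≠ w₂)
    (hsd : ∀ v, inv.dualTransported 𝓛 (weilDualIntertwining W n e hμ hadd₁ hadd₂ hgal) v = 𝓛 v) :
    ((SelmerStructure.selmerGroup
          (Function.update (Function.update 𝓛 (Sum.inr w₁) ⊥) (Sum.inr w₂) ⊥ :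
            SelmerStructure (W.torsionGaloisModule n))).relIndex
        (SelmerStructure.selmerGroup
          (Function.update (Function.update 𝓛 (Sum.inr w₁) ⊤) (Sum.inr w₂) ⊤ :
            SelmerStructure (W.torsionGaloisModule n)))) ^ 2 =
      Nat.card (galoisCohomology ((W.torsionGaloisModule n).toLocal (Sum.inr w₁)) 1) *
        Nat.card (galoisCohomology ((W.torsionGaloisModule n).toLocal (Sum.inr w₂)) 1) := by
  set v₁ : Place K := Sum.inr w₁ with hv₁def
  set v₂ : Place K := Sum.inr w₂ with hv₂def
  have h12 : v₁ ≠ v₂ := fun h => hne (Sum.inr_injective h)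
  have h21 : v₂ ≠ v₁ := fun h => h12 h.symm
  set θ := weilDualIntertwining W n e hμ hadd₁ hadd₂ hgal with hθ
  set 𝓕 : SelmerStructure (W.torsionGaloisModule n) :=
    Function.update (Function.update 𝓛 v₁ ⊥) v₂ ⊥ with h𝓕
  set 𝓖 : SelmerStructure (W.torsionGaloisModule n) :=
    Function.update (Function.update 𝓛 v₁ ⊤) v₂ ⊥ with h𝓖
  set 𝓖' : SelmerStructure (W.torsionGaloisModule n) :=
    Function.update (Function.update 𝓛 v₁ ⊥) v₂ ⊤ with h𝓖'
  set 𝓗 : SelmerStructure (W.torsionGaloisModule n) :=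
    Function.update (Function.update 𝓛 v₁ ⊤) v₂ ⊤ with h𝓗
  have hM : ∀ T : geomTorsion W n, n • T = 0 := fun T => AddSubgroup.torsionBy.nsmul T
  -- pointwise orders
  have hFG : 𝓕 ≤ 𝓖 := update_le_update W n (update_le_update W n le_rfl v₁ bot_le) v₂ le_rfl
  have hGH : 𝓖 ≤ 𝓗 := update_le_update W n le_rfl v₂ bot_le
  have hFG' : 𝓕 ≤ 𝓖' := update_le_update W n le_rfl v₂ bot_le
  have hG'H : 𝓖' ≤ 𝓗 := update_le_update W n (update_le_update W n le_rfl v₁ bot_le) v₂ le_rfl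
  -- `𝓕, 𝓖` differ only at `v₁`; `𝓕, 𝓖'` differ only at `v₂`
  have hdiff₁ : ∀ v ≠ v₁, 𝓕 v = 𝓖 v := fun v hv => by
    by_cases hv2 : v = v₂
    · subst hv2; rw [h𝓕, h𝓖, Function.update_self, Function.update_self]
    · rw [h𝓕, h𝓖, Function.update_of_ne hv2, Function.update_of_ne hv2, Function.update_of_ne hv,
        Function.update_of_ne hv]
  have hdiff₂ : ∀ v ≠ v₂, 𝓕 v = 𝓖' v := fun v hv => by
    rw [h𝓕, h𝓖', Function.update_of_ne hv, Function.update_of_ne hv]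
  -- unramified outside `S`
  have hF : 𝓕.IsUnramifiedOutside S :=
    isUnramifiedOutside_update W n (isUnramifiedOutside_update W n h𝓛 hw₁ ⊥) hw₂ ⊥
  have hG : 𝓖.IsUnramifiedOutside S :=
    isUnramifiedOutside_update W n (isUnramifiedOutside_update W n h𝓛 hw₁ ⊤) hw₂ ⊥
  have hG' : 𝓖'.IsUnramifiedOutside S :=
    isUnramifiedOutside_update W n (isUnramifiedOutside_update W n h𝓛 hw₁ ⊥) hw₂ ⊤
  -- the transported duals: `w⁻¹𝓕^* = 𝓗`, `w⁻¹𝓖^* = 𝓖'`, `w⁻¹𝓖'^* = 𝓖`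
  have hd𝓛 : inv.dualTransported 𝓛 θ = 𝓛 := funext hsd
  have hTF : inv.dualTransported 𝓕 θ = 𝓗 := by
    rw [h𝓕, dualTransported_update_bot W n e hμ hadd₁ hadd₂ hgal inv,
      dualTransported_update_bot W n e hμ hadd₁ hadd₂ hgal inv, hd𝓛]
  have hTG : inv.dualTransported 𝓖 θ = 𝓖' := by
    rw [h𝓖, dualTransported_update_bot W n e hμ hadd₁ hadd₂ hgal inv, hv₁def,
      dualTransported_update_top W n e hμ hadd₁ hadd₂ hgal hnondeg inv hperf, hd𝓛]
  have hTG' : inv.dualTransported 𝓖' θ = 𝓖 := by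
    rw [h𝓖', hv₂def, dualTransported_update_top W n e hμ hadd₁ hadd₂ hgal hnondeg inv hperf,
      dualTransported_update_bot W n e hμ hadd₁ hadd₂ hgal inv, hd𝓛]
  have hdF : (inv.dualSelmerStructure (W.torsionGaloisModule n) 𝓕).selmerGroup =
      𝓗.selmerGroup.map (galoisCohomology.map θ 1) := by
    rw [dualSelmerGroup_eq_map_selmerGroup_dualTransported W n e hμ hadd₁ hadd₂ hgal hnondeg inv 𝓕, hTF]
  have hdG : (inv.dualSelmerStructure (W.torsionGaloisModule n) 𝓖).selmerGroup =
      𝓖'.selmerGroup.map (galoisCohomology.map θ 1) := by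
    rw [dualSelmerGroup_eq_map_selmerGroup_dualTransported W n e hμ hadd₁ hadd₂ hgal hnondeg inv 𝓖, hTG]
  have hdG' : (inv.dualSelmerStructure (W.torsionGaloisModule n) 𝓖').selmerGroup =
      𝓖.selmerGroup.map (galoisCohomology.map θ 1) := by
    rw [dualSelmerGroup_eq_map_selmerGroup_dualTransported W n e hμ hadd₁ hadd₂ hgal hnondeg inv 𝓖', hTG']
  have hinj := map_weilDual_injective W n e hμ hadd₁ hadd₂ hgal hnondeg
  -- the count at `v₁` (pair `𝓕 ≤ 𝓖`): `a · d = #H¹(K_{v₁}, E[n])`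
  have hcount₁ := X11b.PoitouTateCounting.relIndex_selmerGroup_mul_relIndex_dual_eq
    (ρ := W.torsionGaloisModule n) (𝓕 := 𝓕) (𝓖 := 𝓖) (w₀ := w₁) hperf hvan hcomp hM hS hFG hF hG hw₁
    hdiff₁
  rw [hdF, hdG, AddSubgroup.relIndex_map_map_of_injective _ _ hinj] at hcount₁
  have hbt₁ : (𝓕 v₁).relIndex (𝓖 v₁) =
      Nat.card (galoisCohomology ((W.torsionGaloisModule n).toLocal v₁) 1) := by
    rw [h𝓕, h𝓖, Function.update_of_ne h12, Function.update_of_ne h12, Function.update_self,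
      Function.update_self, AddSubgroup.relIndex_bot_left, AddSubgroup.card_top]
  -- the count at `v₂` (pair `𝓕 ≤ 𝓖'`): `c · b = #H¹(K_{v₂}, E[n])`
  have hcount₂ := X11b.PoitouTateCounting.relIndex_selmerGroup_mul_relIndex_dual_eq
    (ρ := W.torsionGaloisModule n) (𝓕 := 𝓕) (𝓖 := 𝓖') (w₀ := w₂) hperf hvan hcomp hM hS hFG' hF hG'
    hw₂ hdiff₂
  rw [hdF, hdG', AddSubgroup.relIndex_map_map_of_injective _ _ hinj] at hcount₂
  have hbt₂ : (𝓕 v₂).relIndex (𝓖' v₂) =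
      Nat.card (galoisCohomology ((W.torsionGaloisModule n).toLocal v₂) 1) := by
    rw [h𝓕, h𝓖', Function.update_self, Function.update_self, AddSubgroup.relIndex_bot_left,
      AddSubgroup.card_top]
  -- `[𝓗 : 𝓕] = a · b = c · d`
  have hab : 𝓕.selmerGroup.relIndex 𝓖.selmerGroup * 𝓖.selmerGroup.relIndex 𝓗.selmerGroup =
      𝓕.selmerGroup.relIndex 𝓗.selmerGroup :=
    AddSubgroup.relIndex_mul_relIndex _ _ _ (selmerGroup_mono hFG) (selmerGroup_mono hGH)
  have hcd : 𝓕.selmerGroup.relIndex 𝓖'.selmerGroup * 𝓖'.selmerGroup.relIndex 𝓗.selmerGroup =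
      𝓕.selmerGroup.relIndex 𝓗.selmerGroup :=
    AddSubgroup.relIndex_mul_relIndex _ _ _ (selmerGroup_mono hFG') (selmerGroup_mono hG'H)
  rw [← hbt₁, ← hbt₂, ← hcount₁, ← hcount₂, sq]
  nth_rewrite 1 [← hab]
  rw [← hcd]
  ring

include hnondeg in
/-- **The two-place count with Tate's local Euler characteristic**: for `n` a prime power and `𝓛`
residually self-dual everywhere,
`[H¹_{𝓛^{v₁v₂}} : H¹_{𝓛_{v₁v₂}}] = (#E(K_{v₁})[n] · #(𝓞_{v₁}/n)) · (#E(K_{v₂})[n] · #(𝓞_{v₂}/n))`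
(`#H¹(K_v, E[n]) = (#E(K_v)[n] · #(𝓞_v/n))²`, tree `natCard_galoisCohomology_one_torsion_adicCompletion_eq_sq`,
from the named fact `localEulerPoincareCharacteristic K_v` — a HYPOTHESIS).
[cite: MilneADT2006, Ch. I, Thm. 2.8 and Lemma 3.3] [cite: Howard2004HeegnerKolyvagin, Thm. 2.1.11 (arXiv:1202.6340 p. 6)] -/
theorem relIndex_update₂_bot_update₂_top_eq_of_localEuler (hperf : inv.IsPerfect)
    (hvan : inv.SumLocalTermEqZero) (hcomp : inv.SelmerComplement) {S : Finset (Place K)}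
    (hS : ∀ v : HeightOneSpectrum (𝓞 K), (Sum.inr v : Place K) ∉ S →
      ((n : ℕ) : 𝓞 K) ∉ v.asIdeal ∧ GaloisRep.IsUnramifiedAt v (W.torsionGaloisModule n))
    {𝓛 : SelmerStructure (W.torsionGaloisModule n)} (h𝓛 : 𝓛.IsUnramifiedOutside S)
    {w₁ w₂ : HeightOneSpectrum (𝓞 K)} (hw₁ : (Sum.inr w₁ : Place K) ∈ S)
    (hw₂ : (Sum.inr w₂ : Place K) ∈ S) (hne : w₁ ≠ w₂)
    (hsd : ∀ v, inv.dualTransported 𝓛 (weilDualIntertwining W n e hμ hadd₁ hadd₂ hgal) v = 𝓛 v)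
    (hn : IsPrimePow n) (hEP₁ : localEulerPoincareCharacteristic (w₁.adicCompletion K))
    (hEP₂ : localEulerPoincareCharacteristic (w₂.adicCompletion K)) :
    (SelmerStructure.selmerGroup
          (Function.update (Function.update 𝓛 (Sum.inr w₁) ⊥) (Sum.inr w₂) ⊥ :
            SelmerStructure (W.torsionGaloisModule n))).relIndex
        (SelmerStructure.selmerGroup
          (Function.update (Function.update 𝓛 (Sum.inr w₁) ⊤) (Sum.inr w₂) ⊤ :
            SelmerStructure (W.torsionGaloisModule n))) =
      (Nat.card (nsmulAddMonoidHom n : (W.baseChange (w₁.adicCompletion K)).toAffine.Point →+ _).ker *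
          Nat.card (w₁.adicCompletionIntegers K ⧸ Ideal.span {(n : w₁.adicCompletionIntegers K)})) *
        (Nat.card (nsmulAddMonoidHom n : (W.baseChange (w₂.adicCompletion K)).toAffine.Point →+ _).ker *
          Nat.card (w₂.adicCompletionIntegers K ⧸ Ideal.span {(n : w₂.adicCompletionIntegers K)})) := by
  have h := relIndex_update₂_bot_update₂_top_sq_eq W n e hμ hadd₁ hadd₂ hgal hnondeg inv hperf hvan
    hcomp hS h𝓛 hw₁ hw₂ hne hsd
  -- `(E[n]).toLocal (inr w) = E[n]|_{Γ_{K_w}}` definitionally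
  have h₁ : Nat.card (galoisCohomology ((W.torsionGaloisModule n).toLocal (Sum.inr w₁)) 1) =
      (Nat.card (nsmulAddMonoidHom n : (W.baseChange (w₁.adicCompletion K)).toAffine.Point →+ _).ker *
        Nat.card (w₁.adicCompletionIntegers K ⧸ Ideal.span {(n : w₁.adicCompletionIntegers K)})) ^ 2 :=
    natCard_galoisCohomology_one_torsion_adicCompletion_eq_sq W w₁ n hn hEP₁
  have h₂ : Nat.card (galoisCohomology ((W.torsionGaloisModule n).toLocal (Sum.inr w₂)) 1) =
      (Nat.card (nsmulAddMonoidHom n : (W.baseChange (w₂.adicCompletion K)).toAffine.Point →+ _).ker *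
        Nat.card (w₂.adicCompletionIntegers K ⧸ Ideal.span {(n : w₂.adicCompletionIntegers K)})) ^ 2 :=
    natCard_galoisCohomology_one_torsion_adicCompletion_eq_sq W w₂ n hn hEP₂
  rw [h₁, h₂, ← mul_pow] at h
  exact Nat.pow_left_injective two_ne_zero h

end TwoPlaces

/-! ## §4. The Kummer structure at two places: `[Sel^{(n)} relaxed at v₁,v₂ : strict at v₁,v₂]` -/

section KummerTwoPlaces

attribute [local instance] absoluteGaloisGroup_compactSpace
attribute [local instance] finite_geomTorsion_of_neZero Literature.NumberTheory.EllipticCurves.finite_muCarrier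

open Summit.BirchSwinnertonDyer.Rank1Residual.X11b.LocBridge
open Summit.BirchSwinnertonDyer.Rank1Residual.X5.SelfDualCount

variable {K : Type} [Field K] [NumberField K] (W : WeierstrassCurve K) [W.IsElliptic] (n : ℕ) [NeZero n]

omit [W.IsElliptic] [NeZero n] in
/-- `kummerStrict W n {v₁, v₂}` is the Kummer structure made strict at `v₁` and at `v₂`.
[cite: Howard2004HeegnerKolyvagin, Def. 2.1.1 (arXiv:1202.6340 p. 5)] -/
theorem kummerStrict_pair_eq_update₂ {v₁ v₂ : Place K} (h : v₁ ≠ v₂) :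
    X11b.KummerPT.kummerStrict W n {v₁, v₂} =
      Function.update (Function.update (W.kummerSelmerStructure (n : ℤ)) v₁ ⊥) v₂ ⊥ := by
  funext v
  by_cases hv2 : v = v₂
  · subst hv2
    rw [X11b.KummerPT.kummerStrict_of_mem W n _ (by simp), Function.update_self]
  · by_cases hv1 : v = v₁
    · subst hv1
      rw [X11b.KummerPT.kummerStrict_of_mem W n _ (by simp), Function.update_of_ne hv2,
        Function.update_self]
    · rw [X11b.KummerPT.kummerStrict_of_not_mem W n _ (by simp [hv1, hv2]), Function.update_of_ne hv2,
        Function.update_of_ne hv1]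

omit [W.IsElliptic] [NeZero n] in
/-- `kummerRelaxed W n {v₁, v₂}` is the Kummer structure relaxed at `v₁` and at `v₂`.
[cite: MilneADT2006, Ch. I §6, (6.5) and Lemma 6.15] -/
theorem kummerRelaxed_pair_eq_update₂ {v₁ v₂ : Place K} (h : v₁ ≠ v₂) :
    X11b.KummerPT.kummerRelaxed W n {v₁, v₂} =
      Function.update (Function.update (W.kummerSelmerStructure (n : ℤ)) v₁ ⊤) v₂ ⊤ := by
  funext v
  by_cases hv2 : v = v₂
  · subst hv2
    rw [X11b.KummerPT.kummerRelaxed_of_mem W n _ (by simp), Function.update_self]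
  · by_cases hv1 : v = v₁
    · subst hv1
      rw [X11b.KummerPT.kummerRelaxed_of_mem W n _ (by simp), Function.update_of_ne hv2,
        Function.update_self]
    · rw [X11b.KummerPT.kummerRelaxed_of_not_mem W n _ (by simp [hv1, hv2]), Function.update_of_ne hv2,
        Function.update_of_ne hv1]

/-- **THE KUMMER COUNT AT TWO PLACES:
`[H¹_{kummerRelaxed {v₁,v₂}} : H¹_{kummerStrict {v₁,v₂}}] = (#E(K_{v₁})[n]·#(𝓞_{v₁}/n)) · (#E(K_{v₂})[n]·#(𝓞_{v₂}/n))`**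
for a prime power `n`, two distinct finite places, a Poitou–Tate family `inv` injective at the real
places (the conjuncts of the named fact `poitouTate_selmerStructure_duality_real K` — HYPOTHESES) and
Tate's local Euler characteristic at the finite places (named fact `localEulerPoincareCharacteristic`,
a HYPOTHESIS); the Kummer structure is residually self-dual at every place
(`X5.SelfDualCount.dualTransported_kummerSelmerStructure_eq`) for the Weil pairing of the tree's PROVED
`exists_weilPairing_holds`. Mazur–Rubin Lemma 3.2 with `|T| = 2`.
[cite: MazurRubin2010, Lemma 3.2 (arXiv:0904.3709 p. 10)]
[cite: MilneADT2006, Ch. I, Thm. 2.8, Cor. 3.4, Thm. 4.10 and Lemma 6.15]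
[cite: Howard2004HeegnerKolyvagin, Thm. 2.1.11 (arXiv:1202.6340 p. 6)] -/
theorem relIndex_kummerStrict_kummerRelaxed_pair_eq (hn : IsPrimePow n) (inv : LocalInvariants K n)
    (hperf : inv.IsPerfect) (hvan : inv.SumLocalTermEqZero) (hcomp : inv.SelmerComplement)
    (hEP : ∀ v : HeightOneSpectrum (𝓞 K), localEulerPoincareCharacteristic (v.adicCompletion K))
    (hreal : ∀ w : InfinitePlace K, w.IsReal → Injective (inv (Sum.inl w)))
    {w₁ w₂ : HeightOneSpectrum (𝓞 K)} (hne : w₁ ≠ w₂) :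
    (X11b.KummerPT.kummerStrict W n {(Sum.inr w₁ : Place K), Sum.inr w₂}).selmerGroup.relIndex
        (X11b.KummerPT.kummerRelaxed W n {(Sum.inr w₁ : Place K), Sum.inr w₂}).selmerGroup =
      (Nat.card (nsmulAddMonoidHom n : (W.baseChange (w₁.adicCompletion K)).toAffine.Point →+ _).ker *
          Nat.card (w₁.adicCompletionIntegers K ⧸ Ideal.span {(n : w₁.adicCompletionIntegers K)})) *
        (Nat.card (nsmulAddMonoidHom n : (W.baseChange (w₂.adicCompletion K)).toAffine.Point →+ _).ker *
          Nat.card (w₂.adicCompletionIntegers K ⧸ Ideal.span {(n : w₂.adicCompletionIntegers K)})) := by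
  have h12 : (Sum.inr w₁ : Place K) ≠ Sum.inr w₂ := fun h => hne (Sum.inr_injective h)
  rw [kummerStrict_pair_eq_update₂ W n h12, kummerRelaxed_pair_eq_update₂ W n h12]
  -- `n = p^k`, `p` prime, `k ≥ 1`
  obtain ⟨p, k, hp, hk, rfl⟩ := (isPrimePow_nat_iff n).mp hn
  haveI : Fact p.Prime := ⟨hp⟩
  -- a Weil pairing on `E[p^k]` (PROVED in the tree: `exists_weilPairing_holds`, Silverman III.8.1)
  obtain ⟨e, hμ, hadd₁, hadd₂, halt, hnondeg, hgal⟩ := exists_weilPairing_holds W (p ^ k)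
    (hp.two_le.trans (Nat.le_self_pow hk.ne' p)) (Nat.cast_ne_zero.mpr (NeZero.ne (p ^ k)))
  -- a finite exceptional set `S ⊇ {v₁, v₂} ∪ ∞ ∪ {v ∣ p} ∪ {bad}`
  obtain ⟨S, hvS, hinf, hpS, hbad⟩ :=
    X11b.KummerPT.exists_exceptional_finset W p {(Sum.inr w₁ : Place K), Sum.inr w₂}
  have hw₁ : (Sum.inr w₁ : Place K) ∈ S := hvS (by simp)
  have hw₂ : (Sum.inr w₂ : Place K) ∈ S := hvS (by simp)
  have hS : ∀ v : HeightOneSpectrum (𝓞 K), (Sum.inr v : Place K) ∉ S →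
      (((p ^ k : ℕ) : ℕ) : 𝓞 K) ∉ v.asIdeal ∧
        GaloisRep.IsUnramifiedAt v (W.torsionGaloisModule ((p ^ k : ℕ) : ℤ)) := fun v hv => by
    have hpv : ((p : ℕ) : 𝓞 K) ∉ v.asIdeal := fun h => hv (hpS v h)
    have hgood : W.HasGoodReductionAt v := by_contra fun h => hv (hbad v h)
    have hpkv : ((p ^ k : ℕ) : 𝓞 K) ∉ v.asIdeal := by
      rw [Nat.cast_pow]
      exact fun h => hpv (v.isPrime.mem_of_pow_mem k h)
    exact ⟨hpkv, X11b.AcSelmer.isUnramifiedAt_torsionGaloisModule W hgood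
      (by rw [Int.cast_natCast]; exact hpkv)⟩
  have h𝓚 : SelmerStructure.IsUnramifiedOutside (W.kummerSelmerStructure ((p ^ k : ℕ) : ℤ)) S :=
    X11b.KummerDuality.kummerSelmerStructure_isUnramifiedOutside W p k S hinf hpS hbad
  exact relIndex_update₂_bot_update₂_top_eq_of_localEuler W (p ^ k) e hμ hadd₁ hadd₂ hgal hnondeg inv
    hperf hvan hcomp hS h𝓚 hw₁ hw₂ hne
    (fun v => dualTransported_kummerSelmerStructure_eq W (p ^ k) e hμ hadd₁ hadd₂ hgal halt hnondeg inv hn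
      hperf hEP hreal v) hn (hEP w₁) (hEP w₂)

end KummerTwoPlaces

-- END VERBATIM: patched-module lines 383–674

end Summit.BirchSwinnertonDyer.Rank1Residual.X11b.CongruentTransfer

end
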